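import Literature.RepresentationTheory.BorelWallach2000.U11PrimaryMultiplicity
import Literature.Algebra.Module.CompositionMultiplicityDirectSum
import HarnessLib

/-!
# The length and the multiplicities of a `(𝔤, K)`-module of `U(1,1)` over its primary decomposition:
# `ℓ(M) = Σ_χ ℓ(P_χ M)`, `[M : L] = Σ_χ [P_χ M : L]`, `#{χ | P_χ M ≠ 0} ≤ ℓ(M)` (Knapp–Vogan Prop. 7.20, counted)

Family `hodge`, lane `lit-hodgefound` (foundations library; seat `lit-hodgefound-p39`, generation 33, row g33-#10); topic
`RepresentationTheory/BorelWallach2000`, namespace `…BorelWallach2000.U11Primary` (continued).  Sequel of `U11PrimaryDecomposition`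
(`primary hM μ λ = P_{(μ,λ)}(M)`, `isInternal_primary : M = ⊕_{(μ,λ)} P_{(μ,λ)}(M)` for a `(Z, C)`-finite `M`, `finite_setOf_primary_ne_bot`),
`U11PrimaryMultiplicity` (g33-#6: `[P_χ(M) : L] = [M : L]`) and of the generic g33-#9 `Algebra/Module/CompositionMultiplicityDirectSum`
(`ℓ` and `[· : S]` are additive on internal direct sums with finitely many non-zero members).  Knapp–Vogan Prop. 7.20: «`V = ⊕_χ P_χ(V)` …
only finitely many of them are nonzero» — here COUNTED: the length and every composition factor multiplicity of `M` are the sums of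
those of its primary components, and a module of length `ℓ` has at most `ℓ` non-zero primary components.
Theorems only (0 definitions), 0 `sorry`, no named fact (net debt 0, D-0026).

## The sources

A. W. Knapp, D. A. Vogan, *Cohomological Induction and Unitary Representations* (1995) [KnappVogan1995, §VII.2 Prop. 7.20, §VII.13
Cor. 7.207 (proof: «we may assume that `V` has a generalized infinitesimal character»), App. A §3 Cor. A.27]; A. J. Berrick, M. E. Keating
(2000) [BerrickKeating2000, Thm. 4.1.12 (ii)] (additivity of length and multiplicities).

## What is formalised (`R = GKRing G11`, `M` a `(𝔤, K)`-module of `U(1,1)` over `R`)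

* §1 **`length_eq_sum_primary_finset : ℓ(M) = Σ_{χ ∈ s} ℓ(P_χ M)`** for a `(Z, C)`-finite `M` and any finset `s` containing the non-zero
  components; `length_eq_sum_primary` (sum over the non-zero components); `length_primary_le`.
* §2 **`compMult_eq_sum_primary_finset : [M : L] = Σ_{χ ∈ s} [P_χ M : L]`** for `M` of finite length; `compMult_eq_sum_primary`.
* §3 **`card_primary_ne_bot_le_length : #{χ | P_χ M ≠ 0} ≤ ℓ(M)`**; `exists_primary_ne_bot_of_compMult_pos` (an irreducible `L`
  occurring in `M` has its generalized infinitesimal character among the finitely many `χ` with `P_χ M ≠ 0`).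

## Mathlib / Literature search

`U11Primary.isInternal_primary`, `finite_setOf_primary_ne_bot`, `isFiniteLength_primary`, `isFiniteLength_iff_forall_primary` (tree);
g33-#6 `exists_hasGenInfChar_of_isSimpleModule`, `primary_ne_bot_of_compMult_pos`, `compMult_primary`; g33-#9
`JordanHoelder.length_eq_sum_of_isInternal_finset/_of_finite`, `compMult_eq_sum_of_isInternal_finset/_of_finite`,
`card_toFinset_ne_bot_le_length`; `U11HC.isFiniteLength_iff_admissible_and_isZCFinite`.
`rg -n 'length_eq_sum_primary|card_primary' BorelWallach2000` → nothing before this file.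

## References

* A. W. Knapp, D. A. Vogan, *Cohomological Induction and Unitary Representations*, Princeton Math. Ser. 45 (1995), §VII.2 Prop. 7.20,
  §VII.13 Cor. 7.207, App. A §3 Cor. A.27. [KnappVogan1995]
* A. J. Berrick, M. E. Keating, *An Introduction to Rings and Modules*, CUP (2000), Thm. 4.1.12. [BerrickKeating2000]
-/

noncomputable section

open scoped Matrix ComplexConjugate
open Module Polynomial

namespace Literature.RepresentationTheory.BorelWallach2000

open Literature.Algebra.Lie Literature.Algebra.Lie.ChevalleyEilenberg
open Literature.Algebra.Module
open Literature.NumberTheory.Automorphic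
open Literature.RepresentationTheory.KonnoKonno2007 Literature.RepresentationTheory.KonnoKonno2007.RealDualPair
open Literature.RepresentationTheory.KonnoKonno2007.RealDualPair.UForm
open Literature.LinearAlgebra
open U11HolDS

-- Mathlib idiom (as in `GKModules`, `GKCohomology`): commutator bracket on `Module.End` / matrices
attribute [local instance 100] LieRing.ofAssociativeRing

-- carriers `↥W`, `M ⧸ W`, `Factor` over `GKRing G11` with their `ℂ`-structures (as in `GKModuleRing` §7–§8)
set_option maxSynthPendingDepth 4

namespace U11Primary

open U11Irred U11HC

variable {M : Type*} [AddCommGroup M] [Module ℂ M] [Module (GKRing G11) M] [IsScalarTower ℂ (GKRing G11) M]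
  (hM : IsGKModule G11 (GKRing.actK G11 M) (GKRing.actLie G11 M))
  {L : Type*} [AddCommGroup L] [Module ℂ L] [Module (GKRing G11) L] [IsScalarTower ℂ (GKRing G11) L]

/-! ## §1 The length over the primary decomposition -/

/-- **`ℓ(M) = Σ_{χ ∈ s} ℓ(P_χ M)`** for a `(Z, C)`-finite `(𝔤, K)`-module `M` of `U(1,1)` and ANY finset `s` of parameters `χ = (μ, λ)`
containing those with `P_χ M ≠ 0` («`V = ⊕ P_χ(V)` … only finitely many of them are nonzero», and the length is additive).
[cite: KnappVogan1995, §VII.2 Prop. 7.20, App. A §3 Cor. A.27] [cite: BerrickKeating2000, Thm. 4.1.12 (ii)] -/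
theorem length_eq_sum_primary_finset (hZC : IsZCFinite (GKRing.actLie G11 M)) (s : Finset (ℂ × ℂ))
    (hs : ∀ p : ℂ × ℂ, primary hM p.1 p.2 ≠ ⊥ → p ∈ s) :
    Module.length (GKRing G11) M = ∑ p ∈ s, Module.length (GKRing G11) (primary hM p.1 p.2) :=
  JordanHoelder.length_eq_sum_of_isInternal_finset (fun p : ℂ × ℂ => primary hM p.1 p.2) (isInternal_primary hM hZC) s hs

/-- **`ℓ(M) = Σ_{P_χ M ≠ 0} ℓ(P_χ M)`** (the sum over the finitely many non-zero primary components).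
[cite: KnappVogan1995, §VII.2 Prop. 7.20, App. A §3 Cor. A.27] [cite: BerrickKeating2000, Thm. 4.1.12 (ii)] -/
theorem length_eq_sum_primary (hZC : IsZCFinite (GKRing.actLie G11 M)) :
    Module.length (GKRing G11) M =
      ∑ p ∈ (finite_setOf_primary_ne_bot hM hZC).toFinset, Module.length (GKRing G11) (primary hM p.1 p.2) :=
  JordanHoelder.length_eq_sum_of_isInternal_of_finite (fun p : ℂ × ℂ => primary hM p.1 p.2) (isInternal_primary hM hZC) _

/-- The same for a module of FINITE LENGTH (finite length ⟹ `(Z, C)`-finite, `U11HC.isFiniteLength_iff_admissible_and_isZCFinite`).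
[cite: KnappVogan1995, §VII.2 Prop. 7.20, §VII.13 Cor. 7.207] -/
theorem length_eq_sum_primary_finset_of_isFiniteLength (hfl : IsFiniteLength (GKRing G11) M) (s : Finset (ℂ × ℂ))
    (hs : ∀ p : ℂ × ℂ, primary hM p.1 p.2 ≠ ⊥ → p ∈ s) :
    Module.length (GKRing G11) M = ∑ p ∈ s, Module.length (GKRing G11) (primary hM p.1 p.2) :=
  length_eq_sum_primary_finset hM ((isFiniteLength_iff_admissible_and_isZCFinite hM).mp hfl).2 s hs

/-- Each primary component is no longer than the module: `ℓ(P_χ M) ≤ ℓ(M)`. [cite: KnappVogan1995, App. A §3 Cor. A.27] -/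
theorem length_primary_le (μ lam : ℂ) : Module.length (GKRing G11) (primary hM μ lam) ≤ Module.length (GKRing G11) M :=
  Module.length_le_of_injective _ (Submodule.subtype_injective _)

/-! ## §2 Composition factor multiplicities over the primary decomposition -/

omit [Module ℂ L] [IsScalarTower ℂ (GKRing G11) L] in
/-- **`[M : L] = Σ_{χ ∈ s} [P_χ M : L]`** for `M` of finite length and any finset `s` of parameters containing those with `P_χ M ≠ 0`
(the multiplicity type is additive on the decomposition `M = ⊕_χ P_χ M`; with g33-#6 `compMult_primary_of_ne` all terms but the
generalized infinitesimal character of `L` vanish). [cite: KnappVogan1995, §VII.2 Prop. 7.20, App. A §3 Cor. A.27] [cite: BerrickKeating2000, Thm. 4.1.12 (ii)] -/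
theorem compMult_eq_sum_primary_finset (hfl : IsFiniteLength (GKRing G11) M) (s : Finset (ℂ × ℂ))
    (hs : ∀ p : ℂ × ℂ, primary hM p.1 p.2 ≠ ⊥ → p ∈ s) :
    JordanHoelder.compMult (GKRing G11) M L = ∑ p ∈ s, JordanHoelder.compMult (GKRing G11) (primary hM p.1 p.2) L :=
  JordanHoelder.compMult_eq_sum_of_isInternal_finset L (fun p : ℂ × ℂ => primary hM p.1 p.2)
    (isInternal_primary hM ((isFiniteLength_iff_admissible_and_isZCFinite hM).mp hfl).2) s hs
    fun p _ => isFiniteLength_primary hM hfl p.1 p.2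

omit [Module ℂ L] [IsScalarTower ℂ (GKRing G11) L] in
/-- **`[M : L] = Σ_{P_χ M ≠ 0} [P_χ M : L]`** for a `(Z, C)`-finite `M` of finite length.
[cite: KnappVogan1995, §VII.2 Prop. 7.20, App. A §3 Cor. A.27] [cite: BerrickKeating2000, Thm. 4.1.12 (ii)] -/
theorem compMult_eq_sum_primary (hZC : IsZCFinite (GKRing.actLie G11 M)) (hfl : IsFiniteLength (GKRing G11) M) :
    JordanHoelder.compMult (GKRing G11) M L =
      ∑ p ∈ (finite_setOf_primary_ne_bot hM hZC).toFinset, JordanHoelder.compMult (GKRing G11) (primary hM p.1 p.2) L :=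
  compMult_eq_sum_primary_finset hM hfl _ fun _ hp => (finite_setOf_primary_ne_bot hM hZC).mem_toFinset.mpr hp

/-- The sum collapses: for `L` with generalized infinitesimal character `χ = (μ, λ)` and `χ ∈ s`,
`Σ_{χ′ ∈ s} [P_χ′ M : L] = [P_χ M : L]`. [cite: KnappVogan1995, §VII.2 Prop. 7.20, Prop. 7.28] -/
theorem sum_compMult_primary_eq (hfl : IsFiniteLength (GKRing G11) M) {μ lam : ℂ}
    (hLχ : HasGenInfChar (GKRing.actLie G11 L) μ lam) (s : Finset (ℂ × ℂ)) (hmem : (μ, lam) ∈ s) :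
    ∑ p ∈ s, JordanHoelder.compMult (GKRing G11) (primary hM p.1 p.2) L =
      JordanHoelder.compMult (GKRing G11) (primary hM μ lam) L := by
  rw [← Finset.add_sum_erase s _ hmem]
  conv_rhs => rw [← add_zero (JordanHoelder.compMult (GKRing G11) (primary hM μ lam) L)]
  congr 1
  refine Finset.sum_eq_zero fun p hp => ?_
  have hne : (μ, lam) ≠ (p.1, p.2) := fun h => (Finset.mem_erase.mp hp).1 (Prod.ext_iff.mpr ⟨(Prod.ext_iff.mp h).1.symm,
    (Prod.ext_iff.mp h).2.symm⟩)
  exact compMult_primary_of_ne hM hfl hLχ hne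

/-! ## §3 Counting the non-zero primary components -/

/-- **A `(Z, C)`-finite `(𝔤, K)`-module of `U(1,1)` has at most `ℓ(M)` non-zero primary components** (each contributes `≥ 1` to the
length). [cite: KnappVogan1995, §VII.2 Prop. 7.20, App. A §3 Cor. A.27] [cite: BerrickKeating2000, Thm. 4.1.12 (ii)] -/
theorem card_primary_ne_bot_le_length (hZC : IsZCFinite (GKRing.actLie G11 M)) :
    ((finite_setOf_primary_ne_bot hM hZC).toFinset.card : ℕ∞) ≤ Module.length (GKRing G11) M :=
  JordanHoelder.card_toFinset_ne_bot_le_length (fun p : ℂ × ℂ => primary hM p.1 p.2) (isInternal_primary hM hZC) _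

/-- Finset form: for any finset `s`, the number of `χ ∈ s` with `P_χ M ≠ 0` is at most `ℓ(M)`. [cite: KnappVogan1995, §VII.2 Prop. 7.20] -/
theorem card_filter_primary_ne_bot_le_length (hZC : IsZCFinite (GKRing.actLie G11 M)) (s : Finset (ℂ × ℂ))
    [DecidablePred fun p : ℂ × ℂ => primary hM p.1 p.2 ≠ ⊥] :
    ((s.filter fun p => primary hM p.1 p.2 ≠ ⊥).card : ℕ∞) ≤ Module.length (GKRing G11) M := by
  refine le_trans ?_ (card_primary_ne_bot_le_length hM hZC)
  exact_mod_cast Finset.card_le_card fun p hp =>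
    (finite_setOf_primary_ne_bot hM hZC).mem_toFinset.mpr (Finset.mem_filter.mp hp).2

include hM in
/-- **An irreducible `L` occurring in `M` (`[M : L] > 0`) has its generalized infinitesimal character among the finitely many `χ` with
`P_χ M ≠ 0`.** [cite: KnappVogan1995, §VII.2 Prop. 7.20, §VII.13 Cor. 7.207] -/
theorem exists_primary_ne_bot_of_compMult_pos (hL : IsGKModule G11 (GKRing.actK G11 L) (GKRing.actLie G11 L))
    [IsSimpleModule (GKRing G11) L] (hpos : 0 < JordanHoelder.compMult (GKRing G11) M L) :
    ∃ p : ℂ × ℂ, HasGenInfChar (GKRing.actLie G11 L) p.1 p.2 ∧ primary hM p.1 p.2 ≠ ⊥ := by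
  obtain ⟨p, hp⟩ := exists_hasGenInfChar_of_isSimpleModule hL
  exact ⟨p, hp, primary_ne_bot_of_compMult_pos hM hp hpos⟩

include hM in
/-- Hence, for `M` `(Z, C)`-finite: the composition factors of `M` have generalized infinitesimal characters in the finite set
`{χ | P_χ M ≠ 0}`. [cite: KnappVogan1995, §VII.2 Prop. 7.20, §VII.13 Cor. 7.207] -/
theorem mem_toFinset_of_compMult_pos (hZC : IsZCFinite (GKRing.actLie G11 M))
    (hL : IsGKModule G11 (GKRing.actK G11 L) (GKRing.actLie G11 L)) [IsSimpleModule (GKRing G11) L]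
    (hpos : 0 < JordanHoelder.compMult (GKRing G11) M L) :
    ∃ p ∈ (finite_setOf_primary_ne_bot hM hZC).toFinset, HasGenInfChar (GKRing.actLie G11 L) p.1 p.2 := by
  obtain ⟨p, hp, hne⟩ := exists_primary_ne_bot_of_compMult_pos hM hL hpos
  exact ⟨p, (finite_setOf_primary_ne_bot hM hZC).mem_toFinset.mpr hne, hp⟩

end U11Primary

end Literature.RepresentationTheory.BorelWallach2000
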